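import Literature.Barriers.Parity.SiegelZeroDichotomyPairHLStepTwo
import Literature.Barriers.Parity.SiegelZeroDichotomyChowlaStep3Model
import Literature.NumberTheory.Sieve.LandreauInequality
import HarnessLib

/-!
# Tao–Teräväinen 2022, Lemma 5.1 at `k = 2`, `ℓ = 0` — PROVED

Topic `Literature/Barriers/Parity`; a file of the proof DAG of the named fact
`Literature.Barriers.Parity.TaoTeravainen2021_pairHL` (Tao–Teräväinen, *The Hardy–Littlewood–Chowla
conjecture in the presence of a Siegel zero*, J. London Math. Soc. 106 (2022), arXiv:2109.06291,
Corollary 1.8 (i); see `SiegelZeroDichotomyPairHL.lean`, `SiegelZeroDichotomyPairHLSiegelModel.lean`,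
`SiegelZeroDichotomyPairHLStepTwo.lean`). It DISCHARGES the named fact
`Literature.Barriers.Parity.TaoTeravainen2021_lemma51_pair` of `SiegelZeroDichotomyPairHLStepTwo.lean`
— the source's Lemma 5.1 ("For `n ≤ 2x`, we have the bounds `Λν(n) - Λ_Siegel(n) ≪ E(n) + F(n) +
G(n)`", with the majorants (5.4)–(5.6)) at the scales `R = x^{1/log^{1/10} η}`, `R₀ = x^{1/√log η}`,
`D = x^{ε₀/20}` of `k = 2`, `ℓ = 0` — as `TaoTeravainen2021_lemma51_pair_holds`, with no new
definition of substance and no new named fact. After this file the inputs of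
`TaoTeravainen2021_prop52_pair_of_stepTwo` that remain named facts are (5.7), (5.8), (5.9)
(`TaoTeravainen2021_eq57_pair`, `_eq58_pair`, `_eq59_pair`).

## What the source prints (arXiv:2109.06291, §5, proof of Lemma 5.1) and how it is formalised

* "If `n` is divisible by an exceptional `R₀ < p* ≤ √(2x)`, then `E ≫ τ(n) ν(n) log x`, and (5.3)
  then follows from (5.2) and (5.4). Similarly if `n` is divisible by the square of a prime `p > R₀`
  (which must then necessarily be at most `√(2x)`)." — Case 1 of the proof below: the crude bound
  `|Λν(n) - Λ_Siegel(n)| ≤ τ(n) ν(n) log n ≤ 2 τ(n) ν(n) log x ≤ 2E(n)` (`sum_abs_oneConvChi_mul_le`).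
* "Next, suppose that `n` is not divisible by any exceptional prime `p* > R₀`, nor by any square `p²`
  of a prime `p > R₀`. We write `χ ∗ log = (1∗χ) ∗ μ ∗ log = (1∗χ) ∗ Λ`. Note that `1∗χ(d)` is only
  non-zero when `d` is the product of exceptional primes times a perfect square, so if `d|n` and `n`
  is as above then `d` must be the product of some primes less than or equal to `R₀`. Also
  `∑_{d|n} Λ(d) = log n`. Thus … `χ∗log(n) ≤ τ(n_(≤R₀)) log n` … Applying (3.10) (with `n` replaced
  by `n_(≤R₀)`), we have `τ(n_(≤R₀)) ≪ ∑_{1 < d ≤ D: d|n} τ_(≤R₀)(d)^{O(1)}` and the claim (5.3) now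
  follows in this case from (5.5)." — Case 2 below: `oneConvChi` (`1 ∗ χ`), `charLog_eq_sum`
  (`χ ∗ log = (1∗χ) ∗ Λ`, Dirichlet algebra with Mathlib's `Λ ∗ ζ = log`), `oneConvChi_eq_zero` and
  `dvd_smoothPart_of_oneConvChi_ne_zero` (the support of `1 ∗ χ`), `sum_le_smoothTau_mul_log`, and
  Landreau's inequality in the tree's proved form `Literature.NumberTheory.Sieve.Landreau.card_divisors_le_sum`
  (Lemma 3.1 (ii) with `ε = ε₀/40`, so that `(2x)^ε ≤ x^{ε₀/20} = D`), fed into the divisor sum of `F`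
  by `landreauSum_le_two_mul_errFSum` (the divisor `1` of `n_(≤R₀)`, absent from (5.5), is dominated
  by the least prime factor of `n_(≤R₀)`, which is `≤ R₀ ≤ D` once `log η ≥ 400/ε₀²` — the source's
  "η sufficiently large depending on the fixed quantities").
* "We are left with the case where `n` is divisible by an exceptional prime `p* > √(2x)`. Then
  `n = dp*` for some `d < √(2x)`. The only factors of `n` that are less than or equal to `R` are
  factors of `d` as well, thus `ν(n) = ν(d)`. Since `χ ∗ log(n) = χ ∗ 1 ∗ Λ(n)` and `χ∗1` vanishes
  at all factors of `n` except for `1` and `p*`, we have `χ ∗ log(n) = Λ(n) + (1+χ(p*)) Λ(d)` and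
  thus `Λ(n) - Λ_Siegel(n) ≪ Λν(d)`. If `p* > 2x/R^{1/2}` then `d ≤ R^{1/2}`, and hence `ν(d)`
  vanishes by (2.14). The claim (5.3) now follows in this case from (5.6)." — Case 3 below:
  `selbergSieve_mul_prime` (`ν(dp*) = ν(d)`, `p* ≥ R`), `selbergSieve_eq_zero_of_sq_le` (`ν(d) = 0`
  for `1 < d ≤ R^{1/2}`, via `∑_{a ∣ d} μ(a) = 0` — the tree's
  `Literature.NumberTheory.Sieve.sum_divisors_moebius_real`), and `sum_le_of_eq_mul_prime`. As
  recorded in design note 3 of `SiegelZeroDichotomyPairHLStepTwo.lean`, the display "`χ∗1` vanishes at all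
  factors of `n` except for `1` and `p*`" holds only up to the `R₀`-smooth divisors of `d`; in general
  `(χ ∗ log)(n) - Λ(n) = ∑_{1 < a ∣ d} (1∗χ)(a) Λ(dp*/a) + (1 + χ(p*)) ∑_{a ∣ d} (1∗χ)(a) Λ(d/a)`,
  whose terms with `a > 1` are handled exactly as in Case 2 (they are `≪ F(n)` by Landreau's
  inequality), and whose term `a = 1` of the second sum is the printed `(1+χ(p*)) Λ(d)`; the LEMMA as
  stated is what is proved.
  [cite: TaoTeravainen2021, §5, Lemma 5.1 and its proof; §2.3–§2.5 ((2.3)–(2.5), (2.14)); Lemma 3.1 (3.10)]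

## Constants

For a fixed cutoff `ψ` and `0 < ε₀ < 1` the witnesses are: the exponent `A = M(ε₀/40) = ⌊1 + 80/ε₀⌋₊`
and constant `C_L = 2^{80/ε₀}` of `Landreau.card_divisors_le_sum`, `C = 8 C_L + 2`, and
`η₁ = max(e^{1024}, e^{400/ε₀²})` (`R ≤ x^{1/2}` by `pairScaleR_le_sqrt`, and `R₀ ≤ D`); `x ≥ q ≥ 3`
comes from the range (1.7) and `IsSiegelZero.three_le`. The upper constraint `x ≤ q^{η^{1/2}}` of
(1.7) is not used.
-/

noncomputable section

open Finset
open scoped ArithmeticFunction.vonMangoldt ArithmeticFunction.Moebius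

namespace Literature.Barriers.Parity

namespace TaoTeravainen

open Literature.NumberTheory.Sieve (smoothPart smoothPart_ne_zero factorization_smoothPart
  smoothPart_dvd smoothPart_mem_smoothNumbers)

variable {q : ℕ} (χ : DirichletCharacter ℂ q)

/-! ### The divisor sum `1 ∗ χ` -/

/-- `1 ∗ χ` as a real arithmetic function: `(1 ∗ χ)(n) = ∑_{d ∣ n} χ(d)` (§5, proof of Lemma 5.1:
"`χ ∗ log = (1∗χ) ∗ μ ∗ log = (1∗χ) ∗ Λ`"). [cite: TaoTeravainen2021, §5 (proof of Lemma 5.1)] -/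
def oneConvChi : ArithmeticFunction ℝ :=
  (ArithmeticFunction.zeta : ArithmeticFunction ℝ) * chiAF χ

/-- `(1 ∗ χ)(n) = ∑_{d ∣ n} Re χ(d)`. [cite: TaoTeravainen2021, §5 (proof of Lemma 5.1)] -/
theorem oneConvChi_apply (n : ℕ) : oneConvChi χ n = ∑ d ∈ n.divisors, realChar χ d := by
  unfold oneConvChi
  rw [ArithmeticFunction.coe_zeta_mul_apply]
  exact Finset.sum_congr rfl fun d hd => chiAF_apply χ (Nat.pos_of_mem_divisors hd).ne'

/-- `|(1 ∗ χ)(n)| ≤ τ(n)`. [cite: TaoTeravainen2021, §5 (proof of Lemma 5.1)] -/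
theorem abs_oneConvChi_le (n : ℕ) : |oneConvChi χ n| ≤ (n.divisors.card : ℝ) := by
  rw [oneConvChi_apply]
  calc |∑ d ∈ n.divisors, realChar χ d| ≤ ∑ d ∈ n.divisors, |realChar χ d| :=
        Finset.abs_sum_le_sum_abs _ _
    _ ≤ ∑ d ∈ n.divisors, (1 : ℝ) := Finset.sum_le_sum fun d _ => abs_realChar_le_one χ d
    _ = n.divisors.card := by simp

/-- `(1 ∗ χ)(1) = 1`. [cite: TaoTeravainen2021, §5 (proof of Lemma 5.1)] -/
theorem oneConvChi_one : oneConvChi χ 1 = 1 := by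
  simp [oneConvChi_apply]

/-- `(1 ∗ χ)(p) = 1 + χ(p)` at a prime. [cite: TaoTeravainen2021, §5 (proof of Lemma 5.1)] -/
theorem oneConvChi_prime {p : ℕ} (hp : p.Prime) : oneConvChi χ p = 1 + realChar χ p := by
  rw [oneConvChi_apply, hp.divisors, Finset.sum_pair hp.one_lt.ne, realChar_one]

/-- `1 ∗ χ` is multiplicative (for quadratic `χ`). [cite: TaoTeravainen2021, §5 (proof of Lemma 5.1)] -/
theorem isMultiplicative_oneConvChi (hχ : χ.IsQuadratic) : (oneConvChi χ).IsMultiplicative :=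
  ArithmeticFunction.isMultiplicative_zeta.natCast.mul (isMultiplicative_chiAF χ hχ)

/-- **The support of `1 ∗ χ`**: "`1∗χ(d)` is only non-zero when `d` is the product of exceptional
primes times a perfect square" — if a non-exceptional prime `p` (`χ(p) = -1`) divides `n` exactly
once, then `(1 ∗ χ)(n) = (1 + χ(p)) (1 ∗ χ)(n/p) = 0`. [cite: TaoTeravainen2021, §5 (proof of Lemma 5.1)] -/
theorem oneConvChi_eq_zero (hχ : χ.IsQuadratic) {p n : ℕ} (hp : p.Prime) (hpn : p ∣ n)
    (hp2 : ¬ p ^ 2 ∣ n) (hχp : realChar χ p = -1) : oneConvChi χ n = 0 := by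
  obtain ⟨m, rfl⟩ := hpn
  have hpm : ¬ p ∣ m := fun h => hp2 (by rw [sq]; exact Nat.mul_dvd_mul_left p h)
  have hcop : p.Coprime m := (Nat.Prime.coprime_iff_not_dvd hp).mpr hpm
  rw [(isMultiplicative_oneConvChi χ hχ).map_mul_of_coprime hcop, oneConvChi_prime χ hp, hχp]
  ring

/-! ### `χ ∗ log = (1 ∗ χ) ∗ Λ` -/

/-- **"`χ ∗ log = (1∗χ) ∗ μ ∗ log = (1∗χ) ∗ Λ`"**: `(χ ∗ log)(n) = ∑_{d ∣ n} (1 ∗ χ)(d) Λ(n/d)`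
(Dirichlet algebra: `log = Λ ∗ 1`). [cite: TaoTeravainen2021, §5 (proof of Lemma 5.1)] -/
theorem charLog_eq_sum (n : ℕ) :
    charLog χ n = ∑ d ∈ n.divisors, oneConvChi χ d * Λ (n / d) := by
  have h1 : charLog χ n = (chiAF χ * ArithmeticFunction.log) n := by
    rw [ArithmeticFunction.mul_apply]
    unfold charLog
    refine Finset.sum_congr rfl fun x hx => ?_
    obtain ⟨hxn, hn⟩ := Nat.mem_divisorsAntidiagonal.mp hx
    have hx1 : x.1 ≠ 0 := by
      rintro h
      rw [h, zero_mul] at hxn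
      exact hn hxn.symm
    rw [chiAF_apply χ hx1, ArithmeticFunction.log_apply]
  have h2 : chiAF χ * ArithmeticFunction.log = oneConvChi χ * Λ := by
    rw [← ArithmeticFunction.vonMangoldt_mul_zeta, oneConvChi]
    ring
  rw [h1, h2, ArithmeticFunction.mul_apply,
    Nat.sum_divisorsAntidiagonal (fun a b => oneConvChi χ a * Λ b)]

/-- `(χ ∗ log)(n) - Λ(n) = ∑_{d ∣ n, d > 1} (1 ∗ χ)(d) Λ(n/d)` (the `d = 1` term is `Λ(n)`).
[cite: TaoTeravainen2021, §5 (proof of Lemma 5.1)] -/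
theorem charLog_sub_vonMangoldt {n : ℕ} (hn : n ≠ 0) :
    charLog χ n - Λ n = ∑ d ∈ n.divisors.erase 1, oneConvChi χ d * Λ (n / d) := by
  rw [charLog_eq_sum, ← Finset.add_sum_erase _ _ (Nat.one_mem_divisors.mpr hn), oneConvChi_one,
    Nat.div_one, one_mul]
  ring

/-- **The basic inequality**: `|Λν(n) - Λ_Siegel(n)| ≤ ν(n) ∑_{d ∣ n, d > 1} |(1 ∗ χ)(d)| Λ(n/d)`
(`Λν - Λ_Siegel = (Λ - χ ∗ log) ν`). [cite: TaoTeravainen2021, §5 (proof of Lemma 5.1)] -/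
theorem abs_sieved_sub_siegel_le (ψ : ℝ → ℝ) (R : ℝ) {n : ℕ} (hn : n ≠ 0) :
    |sievedVonMangoldt ψ R n - vonMangoldtSiegel χ ψ R n| ≤
      selbergSieve ψ R n * ∑ d ∈ n.divisors.erase 1, |oneConvChi χ d| * Λ (n / d) := by
  unfold sievedVonMangoldt vonMangoldtSiegel
  rw [← sub_mul, abs_mul, abs_of_nonneg (selbergSieve_nonneg ψ R n), mul_comm, abs_sub_comm,
    charLog_sub_vonMangoldt χ hn]
  refine mul_le_mul_of_nonneg_left ?_ (selbergSieve_nonneg ψ R n)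
  calc |∑ d ∈ n.divisors.erase 1, oneConvChi χ d * Λ (n / d)|
      ≤ ∑ d ∈ n.divisors.erase 1, |oneConvChi χ d * Λ (n / d)| := Finset.abs_sum_le_sum_abs _ _
    _ = ∑ d ∈ n.divisors.erase 1, |oneConvChi χ d| * Λ (n / d) :=
        Finset.sum_congr rfl fun d _ => by
          rw [abs_mul, abs_of_nonneg ArithmeticFunction.vonMangoldt_nonneg]

/-- The crude bound `∑_{d ∣ n, d > 1} |(1 ∗ χ)(d)| Λ(n/d) ≤ τ(n) log n` ("`Λν(n), Λ_Siegel(n) ≪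
τν(n) log x`", (5.2)). [cite: TaoTeravainen2021, §5 (5.2)] -/
theorem sum_abs_oneConvChi_mul_le (n : ℕ) :
    ∑ d ∈ n.divisors.erase 1, |oneConvChi χ d| * Λ (n / d) ≤ (n.divisors.card : ℝ) * Real.log n := by
  rcases Nat.eq_zero_or_pos n with rfl | hn
  · simp
  calc ∑ d ∈ n.divisors.erase 1, |oneConvChi χ d| * Λ (n / d)
      ≤ ∑ d ∈ n.divisors.erase 1, (n.divisors.card : ℝ) * Λ (n / d) := by
        refine Finset.sum_le_sum fun d hd => ?_
        refine mul_le_mul_of_nonneg_right ?_ ArithmeticFunction.vonMangoldt_nonneg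
        have hdn : d ∣ n := Nat.dvd_of_mem_divisors (Finset.mem_of_mem_erase hd)
        calc |oneConvChi χ d| ≤ (d.divisors.card : ℝ) := abs_oneConvChi_le χ d
          _ ≤ (n.divisors.card : ℝ) := by
              exact_mod_cast Finset.card_le_card (Nat.divisors_subset_of_dvd hn.ne' hdn)
    _ ≤ ∑ d ∈ n.divisors, (n.divisors.card : ℝ) * Λ (n / d) :=
        Finset.sum_le_sum_of_subset_of_nonneg (Finset.erase_subset _ _) fun _ _ _ =>
          mul_nonneg (Nat.cast_nonneg _) ArithmeticFunction.vonMangoldt_nonneg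
    _ = (n.divisors.card : ℝ) * Real.log n := by
        rw [← Finset.mul_sum, Nat.sum_div_divisors n (fun d => Λ d),
          ArithmeticFunction.vonMangoldt_sum]

/-! ### Smooth parts and the support of `1 ∗ χ` -/

/-- A `B`-smooth divisor of `d ≠ 0` divides the `B`-smooth part of `d`. [folklore] -/
theorem dvd_smoothPart_of_dvd {B d a : ℕ} (hd : d ≠ 0) (ha : a ∣ d)
    (hsm : a ∈ Nat.smoothNumbers B) : a ∣ smoothPart B d := by
  have ha0 : a ≠ 0 := Nat.ne_zero_of_mem_smoothNumbers hsm
  rw [← Nat.factorization_le_iff_dvd ha0 (smoothPart_ne_zero B d)]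
  intro p
  rw [factorization_smoothPart]
  split_ifs with hpB
  · exact (Nat.factorization_le_iff_dvd ha0 hd).mpr ha p
  · have : a.factorization p = 0 := by
      rw [Nat.factorization_eq_zero_iff]
      by_cases hp : p.Prime
      · exact Or.inr (Or.inl fun hpa => hpB ((Nat.mem_smoothNumbers'.mp hsm) p hp hpa))
      · exact Or.inl hp
    exact this.le

/-- **Lemma 5.1, the support computation**: if every prime `p ≥ B` dividing `d` is non-exceptional
(`χ(p) = -1`) and divides `d` exactly once, then a divisor `a ∣ d` with `(1 ∗ χ)(a) ≠ 0` is
`B`-smooth, hence divides `d_(≤R₀)` ("if `d|n` and `n` is as above then `d` must be the product of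
some primes less than or equal to `R₀`"; `B = ⌊R₀⌋ + 1`). [cite: TaoTeravainen2021, §5 (proof of Lemma 5.1)] -/
theorem dvd_smoothPart_of_oneConvChi_ne_zero (hχ : χ.IsQuadratic) {B d : ℕ} (hd : d ≠ 0)
    (H : ∀ p : ℕ, p.Prime → p ∣ d → B ≤ p → realChar χ p = -1 ∧ ¬ p ^ 2 ∣ d) {a : ℕ}
    (ha : a ∣ d) (hr : oneConvChi χ a ≠ 0) : a ∣ smoothPart B d := by
  refine dvd_smoothPart_of_dvd hd ha ?_
  rw [Nat.mem_smoothNumbers']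
  intro p hp hpa
  by_contra hpB
  push Not at hpB
  obtain ⟨h1, h2⟩ := H p hp (hpa.trans ha) hpB
  exact hr (oneConvChi_eq_zero χ hχ hp hpa (fun h => h2 (h.trans ha)) h1)

/-- `τ(d_(≤R₀))` if `d_(≤R₀) > 1`, else `0`: the size of `1 ∗ χ` on the divisors of `d` in the
generic case of Lemma 5.1 ("`χ∗log(n) ≤ τ(n_(≤R₀)) log n`"). [cite: TaoTeravainen2021, §5 (proof of Lemma 5.1)] -/
def smoothTau (B d : ℕ) : ℝ :=
  if smoothPart B d = 1 then 0 else ((smoothPart B d).divisors.card : ℝ)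

/-- `smoothTau ≥ 0`. [folklore] -/
theorem smoothTau_nonneg (B d : ℕ) : 0 ≤ smoothTau B d := by
  unfold smoothTau
  split_ifs <;> positivity

/-- Termwise: under the hypothesis of `dvd_smoothPart_of_oneConvChi_ne_zero`, for `1 ≠ a ∣ d`,
`|(1 ∗ χ)(a)| t ≤ smoothTau · t` (`t ≥ 0`). [cite: TaoTeravainen2021, §5 (proof of Lemma 5.1)] -/
theorem abs_oneConvChi_mul_le (hχ : χ.IsQuadratic) {B d : ℕ} (hd : d ≠ 0)
    (H : ∀ p : ℕ, p.Prime → p ∣ d → B ≤ p → realChar χ p = -1 ∧ ¬ p ^ 2 ∣ d) {a : ℕ}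
    (ha : a ∣ d) (ha1 : a ≠ 1) {t : ℝ} (ht : 0 ≤ t) :
    |oneConvChi χ a| * t ≤ smoothTau B d * t := by
  by_cases hr : oneConvChi χ a = 0
  · rw [hr, abs_zero, zero_mul]
    exact mul_nonneg (smoothTau_nonneg B d) ht
  · have ham := dvd_smoothPart_of_oneConvChi_ne_zero χ hχ hd H ha hr
    have hm1 : smoothPart B d ≠ 1 := fun h => ha1 (Nat.dvd_one.mp (h ▸ ham))
    unfold smoothTau
    rw [if_neg hm1]
    refine mul_le_mul_of_nonneg_right ?_ ht
    calc |oneConvChi χ a| ≤ (a.divisors.card : ℝ) := abs_oneConvChi_le χ a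
      _ ≤ ((smoothPart B d).divisors.card : ℝ) := by
          exact_mod_cast Finset.card_le_card
            (Nat.divisors_subset_of_dvd (smoothPart_ne_zero B d) ham)

/-- **Lemma 5.1, generic case** ("`n` is not divisible by any exceptional prime `p* > R₀`, nor by
any square `p²` of a prime `p > R₀`"): `∑_{a ∣ n, a > 1} |(1 ∗ χ)(a)| Λ(n/a) ≤ 1_{n_(≤R₀) > 1}
τ(n_(≤R₀)) log n`. [cite: TaoTeravainen2021, §5 (proof of Lemma 5.1)] -/
theorem sum_le_smoothTau_mul_log (hχ : χ.IsQuadratic) {B n : ℕ} (hn : n ≠ 0)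
    (H : ∀ p : ℕ, p.Prime → p ∣ n → B ≤ p → realChar χ p = -1 ∧ ¬ p ^ 2 ∣ n) :
    ∑ a ∈ n.divisors.erase 1, |oneConvChi χ a| * Λ (n / a) ≤ smoothTau B n * Real.log n := by
  calc ∑ a ∈ n.divisors.erase 1, |oneConvChi χ a| * Λ (n / a)
      ≤ ∑ a ∈ n.divisors.erase 1, smoothTau B n * Λ (n / a) := by
        refine Finset.sum_le_sum fun a ha => ?_
        obtain ⟨ha1, han⟩ := Finset.mem_erase.mp ha
        exact abs_oneConvChi_mul_le χ hχ hn H (Nat.dvd_of_mem_divisors han) ha1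
          ArithmeticFunction.vonMangoldt_nonneg
    _ ≤ ∑ a ∈ n.divisors, smoothTau B n * Λ (n / a) :=
        Finset.sum_le_sum_of_subset_of_nonneg (Finset.erase_subset _ _) fun _ _ _ =>
          mul_nonneg (smoothTau_nonneg B n) ArithmeticFunction.vonMangoldt_nonneg
    _ = smoothTau B n * Real.log n := by
        rw [← Finset.mul_sum, Nat.sum_div_divisors n (fun d => Λ d),
          ArithmeticFunction.vonMangoldt_sum]

/-- **Lemma 5.1, last case** ("`n` is divisible by an exceptional prime `p* > √(2x)`. Then
`n = dp*` …"): for `n = d P` with `P` prime, `P ∤ d`, and `d` as in the generic case,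
`∑_{a ∣ n, a > 1} |(1 ∗ χ)(a)| Λ(n/a) ≤ 2 · 1_{d_(≤R₀) > 1} τ(d_(≤R₀)) log n + 2 Λ(d)` (the divisors
of `n` are `a ∣ d` and `P a'`, `a' ∣ d`; `|(1 ∗ χ)(P a')| = (1 + χ(P)) |(1 ∗ χ)(a')| ≤ 2 |(1 ∗ χ)(a')|`,
and `a = P` contributes `(1 + χ(P)) Λ(d)`). [cite: TaoTeravainen2021, §5 (proof of Lemma 5.1)] -/
theorem sum_le_of_eq_mul_prime (hχ : χ.IsQuadratic) {B n d P : ℕ} (hP : P.Prime)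
    (hnd : n = d * P) (hd : d ≠ 0) (hPd : ¬ P ∣ d)
    (H : ∀ p : ℕ, p.Prime → p ∣ d → B ≤ p → realChar χ p = -1 ∧ ¬ p ^ 2 ∣ d) :
    ∑ a ∈ n.divisors.erase 1, |oneConvChi χ a| * Λ (n / a) ≤
      2 * smoothTau B d * Real.log n + 2 * Λ d := by
  have hn : n ≠ 0 := by rw [hnd]; exact Nat.mul_ne_zero hd hP.ne_zero
  have hrP : |oneConvChi χ P| ≤ 2 := by
    rw [oneConvChi_prime χ hP]
    have h := abs_le.mp (abs_realChar_le_one χ P)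
    rw [abs_le]
    constructor <;> linarith [h.1, h.2]
  -- the termwise bound
  have hterm : ∀ a ∈ n.divisors.erase 1, |oneConvChi χ a| * Λ (n / a) ≤
      2 * smoothTau B d * Λ (n / a) + (if a = P then 2 * Λ d else 0) := by
    intro a ha
    obtain ⟨ha1, han⟩ := Finset.mem_erase.mp ha
    have hadn : a ∣ n := Nat.dvd_of_mem_divisors han
    have hΛ0 : 0 ≤ Λ (n / a) := ArithmeticFunction.vonMangoldt_nonneg
    have hS0 : 0 ≤ smoothTau B d := smoothTau_nonneg B d
    by_cases haP : a = P
    · subst haP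
      rw [if_pos rfl]
      have hna : n / a = d := by rw [hnd, Nat.mul_div_cancel d hP.pos]
      rw [hna]
      have hΛd : 0 ≤ Λ d := ArithmeticFunction.vonMangoldt_nonneg
      calc |oneConvChi χ a| * Λ d ≤ 2 * Λ d := mul_le_mul_of_nonneg_right hrP hΛd
        _ ≤ 2 * smoothTau B d * Λ d + 2 * Λ d := by nlinarith
    · rw [if_neg haP, add_zero]
      by_cases hPa : P ∣ a
      · -- `a = P a'` with `1 ≠ a' ∣ d`
        obtain ⟨a', rfl⟩ := hPa
        have ha'd : a' ∣ d := by
          have : P * a' ∣ P * d := by rw [mul_comm P d, ← hnd]; exact hadn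
          exact Nat.dvd_of_mul_dvd_mul_left hP.pos this
        have ha'1 : a' ≠ 1 := by
          rintro rfl
          exact haP (mul_one P)
        have hPa' : ¬ P ∣ a' := fun h => hPd (h.trans ha'd)
        have hcop : P.Coprime a' := (Nat.Prime.coprime_iff_not_dvd hP).mpr hPa'
        rw [(isMultiplicative_oneConvChi χ hχ).map_mul_of_coprime hcop, abs_mul]
        have hle := abs_oneConvChi_mul_le χ hχ hd H ha'd ha'1 hΛ0 (B := B)
        calc |oneConvChi χ P| * |oneConvChi χ a'| * Λ (n / (P * a'))
            = |oneConvChi χ P| * (|oneConvChi χ a'| * Λ (n / (P * a'))) := by ring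
          _ ≤ 2 * (smoothTau B d * Λ (n / (P * a'))) :=
              mul_le_mul hrP hle (mul_nonneg (abs_nonneg _) hΛ0) (by norm_num)
          _ = 2 * smoothTau B d * Λ (n / (P * a')) := by ring
      · -- `a ∣ d`
        have hcop : a.Coprime P := ((Nat.Prime.coprime_iff_not_dvd hP).mpr hPa).symm
        have had : a ∣ d := hcop.dvd_of_dvd_mul_right (by rw [← hnd]; exact hadn)
        have hle := abs_oneConvChi_mul_le χ hχ hd H had ha1 hΛ0 (B := B)
        calc |oneConvChi χ a| * Λ (n / a) ≤ smoothTau B d * Λ (n / a) := hle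
          _ ≤ 2 * smoothTau B d * Λ (n / a) := by nlinarith [mul_nonneg hS0 hΛ0]
  calc ∑ a ∈ n.divisors.erase 1, |oneConvChi χ a| * Λ (n / a)
      ≤ ∑ a ∈ n.divisors.erase 1,
          (2 * smoothTau B d * Λ (n / a) + (if a = P then 2 * Λ d else 0)) :=
        Finset.sum_le_sum hterm
    _ = ∑ a ∈ n.divisors.erase 1, 2 * smoothTau B d * Λ (n / a) +
          ∑ a ∈ n.divisors.erase 1, (if a = P then 2 * Λ d else 0) := Finset.sum_add_distrib
    _ ≤ 2 * smoothTau B d * Real.log n + 2 * Λ d := by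
        gcongr
        · calc ∑ a ∈ n.divisors.erase 1, 2 * smoothTau B d * Λ (n / a)
              ≤ ∑ a ∈ n.divisors, 2 * smoothTau B d * Λ (n / a) :=
                Finset.sum_le_sum_of_subset_of_nonneg (Finset.erase_subset _ _) fun _ _ _ =>
                  mul_nonneg (mul_nonneg (by norm_num) (smoothTau_nonneg B d))
                    ArithmeticFunction.vonMangoldt_nonneg
            _ = 2 * smoothTau B d * Real.log n := by
                rw [← Finset.mul_sum, Nat.sum_div_divisors n (fun d => Λ d),
                  ArithmeticFunction.vonMangoldt_sum]
        · rw [Finset.sum_ite_eq']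
          split_ifs
          · exact le_rfl
          · exact mul_nonneg (by norm_num) ArithmeticFunction.vonMangoldt_nonneg


/-! ### Two facts about the Selberg sieve `ν` -/

/-- **`ν(dP) = ν(d)` for a prime `P ≥ R`** ("The only factors of `n` that are less than or equal
to `R` are factors of `d` as well, thus `ν(n) = ν(d)`"): the divisors of `dP` not dividing `d` are
multiples of `P`, where `ψ_{≤R}` vanishes. [cite: TaoTeravainen2021, §5 (proof of Lemma 5.1)] -/
theorem selbergSieve_mul_prime {ψ : ℝ → ℝ} (hψ : IsSmoothCutoff ψ) {R : ℝ} (hR : 1 < R) {P : ℕ}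
    (hP : P.Prime) (hPR : R ≤ P) (d : ℕ) :
    selbergSieve ψ R (d * P) = selbergSieve ψ R d := by
  rcases Nat.eq_zero_or_pos d with rfl | hd
  · simp
  unfold selbergSieve
  congr 1
  symm
  refine Finset.sum_subset
    (Nat.divisors_subset_of_dvd (Nat.mul_ne_zero hd.ne' hP.ne_zero) (Dvd.intro P rfl)) ?_
  intro a ha hna
  have hadP : a ∣ d * P := Nat.dvd_of_mem_divisors ha
  have hPa : P ∣ a := by
    by_contra h
    exact hna (Nat.mem_divisors.mpr
      ⟨((Nat.Prime.coprime_iff_not_dvd hP).mpr h).symm.dvd_of_dvd_mul_right hadP, hd.ne'⟩)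
  have ha0 : 0 < a := Nat.pos_of_mem_divisors ha
  have hRa : R ≤ a := hPR.trans (by exact_mod_cast Nat.le_of_dvd ha0 hPa)
  rw [cutoffLE_eq_zero_of_le hψ hR hRa, mul_zero]

/-- **`ν(d) = 0` for `1 < d ≤ R^{1/2}`** ("If `p* > 2x/R^{1/2}` then `d ≤ R^{1/2}`, and hence `ν(d)`
vanishes by (2.14)"): every divisor `a ≤ d ≤ R^{1/2}` has `ψ_{≤R}(a) = ψ(log_R a) = 1`, so the
inner sum is `∑_{a ∣ d} μ(a) = 0`. [cite: TaoTeravainen2021, §5 (proof of Lemma 5.1) and (2.14)] -/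
theorem selbergSieve_eq_zero_of_sq_le {ψ : ℝ → ℝ} (hψ : IsSmoothCutoff ψ) {R : ℝ} (hR : 1 < R)
    {d : ℕ} (hd1 : d ≠ 1) (hdR : (d : ℝ) ^ 2 ≤ R) : selbergSieve ψ R d = 0 := by
  rcases Nat.eq_zero_or_pos d with rfl | hd0
  · simp [selbergSieve]
  unfold selbergSieve
  rw [sq_eq_zero_iff]
  have hlogR : 0 < Real.log R := Real.log_pos hR
  have hcut : ∀ a ∈ d.divisors, cutoffLE ψ R a = 1 := by
    intro a ha
    unfold cutoffLE
    apply hψ.eq_one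
    have ha0 : 0 < a := Nat.pos_of_mem_divisors ha
    have had : (a : ℝ) ≤ d := by exact_mod_cast Nat.divisor_le ha
    have ha1 : (1 : ℝ) ≤ a := by exact_mod_cast ha0
    rw [abs_of_nonneg (div_nonneg (Real.log_nonneg ha1) hlogR.le), div_le_iff₀ hlogR]
    have h2 : Real.log ((a : ℝ) ^ 2) ≤ Real.log R :=
      Real.log_le_log (by positivity) ((pow_le_pow_left₀ (by positivity) had 2).trans hdR)
    rw [Real.log_pow] at h2
    push_cast at h2
    linarith
  calc ∑ a ∈ d.divisors, (μ a : ℝ) * cutoffLE ψ R a = ∑ a ∈ d.divisors, (μ a : ℝ) :=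
        Finset.sum_congr rfl fun a ha => by rw [hcut a ha, mul_one]
    _ = 0 := by rw [Literature.NumberTheory.Sieve.sum_divisors_moebius_real, if_neg hd1]

/-! ### Landreau's inequality feeds the majorant `F` -/

/-- The divisor sum inside `F_A` ((5.5)): `∑_{1 < d ≤ D : d ∣ n} τ_{(≤R₀)}(d)^A`.
[cite: TaoTeravainen2021, Lemma 5.1 (5.5)] -/
def errFSum (R₀ D : ℝ) (A : ℕ) (n : ℕ) : ℝ :=
  ∑ d ∈ n.divisors,
    if 1 < d ∧ (d : ℝ) ≤ D ∧ d ∈ Nat.smoothNumbers (⌊R₀⌋₊ + 1) then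
      ((d.divisors.card : ℕ) : ℝ) ^ A else 0

/-- `F_A = (divisor sum) · ν · log x`. [cite: TaoTeravainen2021, Lemma 5.1 (5.5)] -/
theorem errF_eq (ψ : ℝ → ℝ) (R R₀ D : ℝ) (A : ℕ) (x n : ℕ) :
    errF ψ R R₀ D A x n = errFSum R₀ D A n * selbergSieve ψ R n * Real.log x :=
  rfl

/-- The divisor sum of `F_A` is `≥ 0`. [cite: TaoTeravainen2021, Lemma 5.1 (5.5)] -/
theorem errFSum_nonneg (R₀ D : ℝ) (A : ℕ) (n : ℕ) : 0 ≤ errFSum R₀ D A n :=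
  Finset.sum_nonneg fun d _ => by split_ifs <;> positivity

/-- **The `F`-sum dominates Landreau's short divisor sum of a smooth part**: if `1 ≠ m ∣ n` is
`R₀`-smooth and `R₀ ≤ D`, then `∑_{a ∣ m, a ≤ D} τ(a)^A ≤ 2 ∑_{1 < a ≤ D : a ∣ n} τ_{(≤R₀)}(a)^A`
(the divisors `a > 1` of `m` are `R₀`-smooth divisors of `n`, and the term `a = 1` is at most the
term of the least prime factor of `m`, which is `≤ R₀ ≤ D`). [cite: TaoTeravainen2021, §5 (proof of Lemma 5.1, "Applying (3.10)")] -/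
theorem landreauSum_le_two_mul_errFSum {R₀ D : ℝ} (hR₀D : R₀ ≤ D) {n m : ℕ}
    (hn : n ≠ 0) (hmn : m ∣ n) (hm : m ∈ Nat.smoothNumbers (⌊R₀⌋₊ + 1)) (hm1 : m ≠ 1) (A : ℕ) :
    ∑ a ∈ m.divisors, (if (a : ℝ) ≤ D then ((a.divisors.card : ℕ) : ℝ) ^ A else 0) ≤
      2 * errFSum R₀ D A n := by
  set g : ℕ → ℝ := fun a =>
    if 1 < a ∧ (a : ℝ) ≤ D ∧ a ∈ Nat.smoothNumbers (⌊R₀⌋₊ + 1) then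
      ((a.divisors.card : ℕ) : ℝ) ^ A else 0 with hg
  have hg0 : ∀ a, 0 ≤ g a := fun a => by
    simp only [hg]
    split_ifs <;> positivity
  have hFS : errFSum R₀ D A n = ∑ a ∈ n.divisors, g a := rfl
  have hm0 : m ≠ 0 := Nat.ne_zero_of_mem_smoothNumbers hm
  -- the least prime factor of `m`
  set p₀ := m.minFac with hp₀
  have hp₀p : p₀.Prime := Nat.minFac_prime hm1
  have hp₀m : p₀ ∣ m := Nat.minFac_dvd m
  have hp₀B : p₀ < ⌊R₀⌋₊ + 1 := (Nat.mem_smoothNumbers'.mp hm) p₀ hp₀p hp₀m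
  have hp₀R₀ : (p₀ : ℝ) ≤ R₀ := (lt_floor_add_one_iff hp₀p.one_lt.le R₀).mp hp₀B
  have hp₀D : (p₀ : ℝ) ≤ D := hp₀R₀.trans hR₀D
  have h1D : (1 : ℝ) ≤ D := le_trans (by exact_mod_cast hp₀p.one_lt.le) hp₀D
  -- split off `a = 1`
  rw [← Finset.add_sum_erase _ _ (Nat.one_mem_divisors.mpr hm0)]
  have hone : (if ((1 : ℕ) : ℝ) ≤ D then (((1 : ℕ).divisors.card : ℕ) : ℝ) ^ A else 0) = 1 := by
    rw [if_pos (by exact_mod_cast h1D)]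
    simp
  rw [hone]
  -- the rest is a sum of `g` over `m.divisors.erase 1 ⊆ n.divisors`
  have hrest : ∑ a ∈ m.divisors.erase 1, (if (a : ℝ) ≤ D then ((a.divisors.card : ℕ) : ℝ) ^ A else 0)
      = ∑ a ∈ m.divisors.erase 1, g a := by
    refine Finset.sum_congr rfl fun a ha => ?_
    obtain ⟨ha1, ham⟩ := Finset.mem_erase.mp ha
    have ha1' : 1 < a := by
      have := Nat.pos_of_mem_divisors ham
      omega
    have hasm : a ∈ Nat.smoothNumbers (⌊R₀⌋₊ + 1) :=
      Nat.mem_smoothNumbers_of_dvd hm (Nat.dvd_of_mem_divisors ham)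
    simp only [hg]
    by_cases haD : (a : ℝ) ≤ D
    · rw [if_pos haD, if_pos ⟨ha1', haD, hasm⟩]
    · rw [if_neg haD, if_neg fun h => haD h.2.1]
  have hsub : m.divisors.erase 1 ⊆ n.divisors :=
    (Finset.erase_subset _ _).trans (Nat.divisors_subset_of_dvd hn hmn)
  have hrest_le : ∑ a ∈ m.divisors.erase 1, g a ≤ errFSum R₀ D A n := by
    rw [hFS]
    exact Finset.sum_le_sum_of_subset_of_nonneg hsub fun a _ _ => hg0 a
  -- the term `a = 1` is at most `g p₀ ≤ errFSum`
  have hgp₀ : 1 ≤ g p₀ := by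
    simp only [hg]
    rw [if_pos ⟨hp₀p.one_lt, hp₀D, Nat.mem_smoothNumbers_of_dvd hm hp₀m⟩, hp₀p.divisors,
      Finset.card_pair hp₀p.one_lt.ne]
    norm_num
    exact one_le_pow₀ (by norm_num)
  have hp₀n : p₀ ∈ n.divisors := Nat.mem_divisors.mpr ⟨hp₀m.trans hmn, hn⟩
  have hone_le : (1 : ℝ) ≤ errFSum R₀ D A n := by
    rw [hFS]
    exact hgp₀.trans (Finset.single_le_sum (fun a _ => hg0 a) hp₀n)
  rw [hrest]
  linarith

end TaoTeravainen

/-! ### Lemma 5.1 at `k = 2`, `ℓ = 0` -/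

set_option maxHeartbeats 1000000 in
open TaoTeravainen Literature.NumberTheory.Sieve in
/-- **Tao–Teräväinen 2022, Lemma 5.1 at the scales of `k = 2`, `ℓ = 0` — PROVED**
(`TaoTeravainen2021_lemma51_pair`): "For `n ≤ 2x`, we have the bounds
`Λν(n) - Λ_Siegel(n) ≪ E(n) + F(n) + G(n)`", with `E, F, G` as in (5.4)–(5.6), `R = x^{1/log^{1/10} η}`,
`R₀ = x^{1/√log η}`, `D = x^{ε₀/20}`; here with the exponent `A = ⌊1 + 80/ε₀⌋₊` of Landreau's
inequality (3.10) at `ε = ε₀/40`, the constant `C = 8 · 2^{80/ε₀} + 2` and the threshold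
`η ≥ max(e^{1024}, e^{400/ε₀²})` (which gives `R ≤ x^{1/2}` and `R₀ ≤ D`). The proof is the printed
one: `Λν - Λ_Siegel = -ν ∑_{d ∣ n, d > 1} (1∗χ)(d) Λ(n/d)` (`χ ∗ log = (1∗χ) ∗ Λ`); if an exceptional
prime `p* ∈ (R₀, √(2x)]` or a square `p²`, `p > R₀`, divides `n`, the crude bound `τ(n) ν(n) log n`
is `≤ 2E(n)`; otherwise `1 ∗ χ` vanishes off the `R₀`-smooth divisors (of `n`, resp. of
`d = n/p*` when an exceptional `p* > √(2x)` divides `n`), Landreau's inequality (3.10) bounds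
`τ(n_(≤R₀))` by the divisor sum of `F`, and the remaining term `(1 + χ(p*)) Λ(d) ν(n) = (1 + χ(p*))
Λν(d)` is `≤ 2G(n)` (or vanishes, as `ν(d) = 0` for `1 < d ≤ R^{1/2}`).
[cite: TaoTeravainen2021, Lemma 5.1 (proof), with (3.10), (2.14), (2.3)–(2.5)] -/
theorem TaoTeravainen2021_lemma51_pair_holds : TaoTeravainen2021_lemma51_pair := by
  intro ψ hψ ε₀ hε₀ hε₀1
  obtain ⟨CL, hCL, M, hLand⟩ :=
    Landreau.card_divisors_le_sum (ε := ε₀ / 40) (by positivity)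
  refine ⟨M, 8 * CL + 2, max (Real.exp 1024) (Real.exp (400 / ε₀ ^ 2)), ?_⟩
  intro q _ χ η hS hη x hxlo hxhi n hn1 hn2x
  -- notation for the scales
  set R : ℝ := pairScaleR η x with hRdef
  set R₀ : ℝ := scaleR0 η x with hR₀def
  set D : ℝ := scaleD 2 ε₀ x with hDdef
  set B : ℕ := ⌊R₀⌋₊ + 1 with hBdef
  have hχ : χ.IsQuadratic := hS.2.1
  -- sizes of `η`, `q`, `x`, `n`
  have hη1024 : Real.exp 1024 ≤ η := le_trans (le_max_left _ _) hη
  have hηε : Real.exp (400 / ε₀ ^ 2) ≤ η := le_trans (le_max_right _ _) hη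
  have hη1 : 1 < η := by linarith [hS.ten_le]
  have hlogη : 0 < Real.log η := Real.log_pos hη1
  have hq3 : (3 : ℝ) ≤ q := by exact_mod_cast hS.three_le
  have hx3 : (3 : ℝ) ≤ x :=
    calc (3 : ℝ) ≤ q := hq3
      _ = (q : ℝ) ^ (1 : ℝ) := (Real.rpow_one _).symm
      _ ≤ (q : ℝ) ^ ((41 : ℝ) / 2 + ε₀) :=
          Real.rpow_le_rpow_of_exponent_le (by linarith) (by linarith)
      _ ≤ x := hxlo
  have hx1 : (1 : ℝ) < x := by linarith
  have hx0 : (0 : ℝ) < x := by linarith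
  have hn0 : n ≠ 0 := by omega
  have hnpos : 0 < n := Nat.pos_of_ne_zero hn0
  have hn2x' : (n : ℝ) ≤ 2 * x := by exact_mod_cast hn2x
  have hlogx : 0 < Real.log x := Real.log_pos hx1
  have hlog2x : Real.log (2 * x) ≤ 2 * Real.log x := by
    rw [Real.log_mul (by norm_num) hx0.ne']
    have : Real.log 2 ≤ Real.log x := Real.log_le_log (by norm_num) (by linarith)
    linarith
  have hlogn : Real.log n ≤ 2 * Real.log x :=
    (Real.log_le_log (by exact_mod_cast hnpos) hn2x').trans hlog2x
  have hlogn0 : 0 ≤ Real.log n := Real.log_natCast_nonneg n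
  -- the scales: `1 < R ≤ √x ≤ √(2x)`, `0 ≤ R₀ ≤ D`, `m ≤ 2x ⇒ m^{ε₀/40} ≤ D`
  have hexpR : 0 < 1 / Real.log η ^ ((1 : ℝ) / 10) := by
    have := Real.rpow_pos_of_pos hlogη ((1 : ℝ) / 10)
    positivity
  have hR1 : 1 < R := Real.one_lt_rpow hx1 hexpR
  have hRsqrt : R ≤ Real.sqrt x := pairScaleR_le_sqrt hη1024 hx1.le
  have hRle : R ≤ Real.sqrt (2 * x) := hRsqrt.trans (Real.sqrt_le_sqrt (by linarith))
  have hR₀0 : 0 ≤ R₀ := Real.rpow_nonneg hx0.le _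
  have hR₀D : R₀ ≤ D := by
    show (x : ℝ) ^ (1 / Real.sqrt (Real.log η)) ≤ (x : ℝ) ^ (ε₀ / (10 * ((2 : ℕ) : ℝ)))
    refine Real.rpow_le_rpow_of_exponent_le hx1.le ?_
    have hlogη' : 400 / ε₀ ^ 2 ≤ Real.log η := by
      rw [← Real.log_exp (400 / ε₀ ^ 2)]
      exact Real.log_le_log (Real.exp_pos _) hηε
    have h20 : 20 / ε₀ ≤ Real.sqrt (Real.log η) := by
      rw [show (20 : ℝ) / ε₀ = Real.sqrt ((20 / ε₀) ^ 2) by rw [Real.sqrt_sq (by positivity)]]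
      refine Real.sqrt_le_sqrt ?_
      rw [div_pow]
      norm_num
      exact hlogη'
    have hsqrt0 : 0 < Real.sqrt (Real.log η) := Real.sqrt_pos.mpr hlogη
    have h20' : 20 ≤ ε₀ * Real.sqrt (Real.log η) := (div_le_iff₀' hε₀).mp h20
    rw [div_le_div_iff₀ hsqrt0 (by norm_num), one_mul]
    push_cast
    linarith
  have hD : ∀ m : ℕ, (m : ℝ) ≤ 2 * x → (m : ℝ) ^ (ε₀ / 40) ≤ D := by
    intro m hm
    have hm2 : (m : ℝ) ≤ (x : ℝ) ^ (2 : ℕ) := hm.trans (by nlinarith)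
    calc (m : ℝ) ^ (ε₀ / 40) ≤ ((x : ℝ) ^ (2 : ℕ)) ^ (ε₀ / 40) :=
          Real.rpow_le_rpow (Nat.cast_nonneg m) hm2 (by positivity)
      _ = (x : ℝ) ^ (((2 : ℕ) : ℝ) * (ε₀ / 40)) := by
          rw [Real.rpow_mul hx0.le, Real.rpow_natCast]
      _ = D := by
          show _ = (x : ℝ) ^ (ε₀ / (10 * ((2 : ℕ) : ℝ)))
          congr 1
          push_cast
          ring
  -- Step 0: the basic inequality and the nonnegativity of the majorants
  have hT := abs_sieved_sub_siegel_le χ ψ R hn0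
  have hν0 : 0 ≤ selbergSieve ψ R n := selbergSieve_nonneg ψ R n
  have hE0 : 0 ≤ pairErrE χ ψ η x n := errE_nonneg _ _ _ _ _ _
  have hF0 : 0 ≤ pairErrF ψ η ε₀ M x n := errF_nonneg _ _ _ _ _ _ _
  have hG0 : 0 ≤ pairErrG χ ψ η x n := errG_nonneg _ _ _ _ _
  have hFS0 : 0 ≤ errFSum R₀ D M n := errFSum_nonneg _ _ _ _
  have hFeq : pairErrF ψ η ε₀ M x n = errFSum R₀ D M n * selbergSieve ψ R n * Real.log x := rfl
  -- Landreau: for `d ∣ n`, `1_{d_(≤R₀) > 1} τ(d_(≤R₀)) ≤ 2 C_L · (divisor sum of F)`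
  have hST : ∀ d : ℕ, d ≠ 0 → d ∣ n → smoothTau B d ≤ 2 * CL * errFSum R₀ D M n := by
    intro d hd0 hdn
    unfold smoothTau
    split_ifs with hm1
    · exact mul_nonneg (mul_nonneg (by norm_num) hCL.le) hFS0
    · have hm0 : smoothPart B d ≠ 0 := smoothPart_ne_zero B d
      have hmd : smoothPart B d ∣ d := smoothPart_dvd hd0 B
      have hmn : smoothPart B d ∣ n := hmd.trans hdn
      have hm2x : ((smoothPart B d : ℕ) : ℝ) ≤ 2 * x :=
        le_trans (by exact_mod_cast Nat.le_of_dvd hnpos hmn) hn2x'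
      have hL := hLand (smoothPart B d) hm0 D (hD _ hm2x)
      calc ((smoothPart B d).divisors.card : ℝ) ≤ CL * ∑ a ∈ (smoothPart B d).divisors,
            (if (a : ℝ) ≤ D then ((a.divisors.card : ℕ) : ℝ) ^ M else 0) := hL
        _ ≤ CL * (2 * errFSum R₀ D M n) :=
            mul_le_mul_of_nonneg_left (landreauSum_le_two_mul_errFSum hR₀D hn0 hmn
              (smoothPart_mem_smoothNumbers B d) hm1 M) hCL.le
        _ = 2 * CL * errFSum R₀ D M n := by ring
  -- from `B ≤ p` to `R₀ < p`
  have hBR₀ : ∀ p : ℕ, B ≤ p → R₀ < p := fun p hp =>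
    (Nat.floor_lt hR₀0).mp (Nat.lt_of_succ_le hp)
  -- Case 1: an exceptional prime in `(R₀, √(2x)]`, or a square `p²` with `p > R₀`, divides `n`
  by_cases hEcase : ∃ p : ℕ, p.Prime ∧ p ∣ n ∧ R₀ < p ∧ (p : ℝ) ≤ Real.sqrt (2 * x) ∧
      (realChar χ p ≠ -1 ∨ p ^ 2 ∣ n)
  · obtain ⟨p, hp, hpn, hpR₀, hpsq, hor⟩ := hEcase
    have hprange : p ∈ Finset.range (n + 1) :=
      Finset.mem_range.mpr (Nat.lt_succ_of_le (Nat.le_of_dvd hnpos hpn))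
    have hEge : (n.divisors.card : ℝ) * selbergSieve ψ R n * Real.log x ≤ pairErrE χ ψ η x n := by
      show _ ≤ errE χ ψ R R₀ x n
      unfold errE
      have hcount : (1 : ℝ) ≤
          (#((Finset.range (n + 1)).filter fun p : ℕ =>
              p.Prime ∧ realChar χ p ≠ -1 ∧ R₀ < (p : ℝ) ∧ (p : ℝ) ≤ Real.sqrt (2 * x) ∧ p ∣ n) : ℝ) +
            #((Finset.range (n + 1)).filter fun p : ℕ =>
              p.Prime ∧ R₀ < (p : ℝ) ∧ (p : ℝ) ≤ Real.sqrt (2 * x) ∧ p ^ 2 ∣ n) := by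
        rcases hor with h | h
        · have h1 : 1 ≤ #((Finset.range (n + 1)).filter fun p : ℕ =>
              p.Prime ∧ realChar χ p ≠ -1 ∧ R₀ < (p : ℝ) ∧ (p : ℝ) ≤ Real.sqrt (2 * x) ∧ p ∣ n) :=
            Finset.card_pos.mpr ⟨p, Finset.mem_filter.mpr ⟨hprange, hp, h, hpR₀, hpsq, hpn⟩⟩
          have h1' : (1 : ℝ) ≤ #((Finset.range (n + 1)).filter fun p : ℕ =>
              p.Prime ∧ realChar χ p ≠ -1 ∧ R₀ < (p : ℝ) ∧ (p : ℝ) ≤ Real.sqrt (2 * x) ∧ p ∣ n) := by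
            exact_mod_cast h1
          linarith [(Nat.cast_nonneg _ : (0 : ℝ) ≤ #((Finset.range (n + 1)).filter fun p : ℕ =>
              p.Prime ∧ R₀ < (p : ℝ) ∧ (p : ℝ) ≤ Real.sqrt (2 * x) ∧ p ^ 2 ∣ n))]
        · have h1 : 1 ≤ #((Finset.range (n + 1)).filter fun p : ℕ =>
              p.Prime ∧ R₀ < (p : ℝ) ∧ (p : ℝ) ≤ Real.sqrt (2 * x) ∧ p ^ 2 ∣ n) :=
            Finset.card_pos.mpr ⟨p, Finset.mem_filter.mpr ⟨hprange, hp, hpR₀, hpsq, h⟩⟩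
          have h1' : (1 : ℝ) ≤ #((Finset.range (n + 1)).filter fun p : ℕ =>
              p.Prime ∧ R₀ < (p : ℝ) ∧ (p : ℝ) ≤ Real.sqrt (2 * x) ∧ p ^ 2 ∣ n) := by
            exact_mod_cast h1
          linarith [(Nat.cast_nonneg _ : (0 : ℝ) ≤ #((Finset.range (n + 1)).filter fun p : ℕ =>
              p.Prime ∧ realChar χ p ≠ -1 ∧ R₀ < (p : ℝ) ∧ (p : ℝ) ≤ Real.sqrt (2 * x) ∧ p ∣ n))]
      have hP : 0 ≤ (n.divisors.card : ℝ) * selbergSieve ψ R n * Real.log x := by positivity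
      calc (n.divisors.card : ℝ) * selbergSieve ψ R n * Real.log x
          = 1 * ((n.divisors.card : ℝ) * selbergSieve ψ R n * Real.log x) := (one_mul _).symm
        _ ≤ _ * ((n.divisors.card : ℝ) * selbergSieve ψ R n * Real.log x) :=
            mul_le_mul_of_nonneg_right hcount hP
        _ = _ := by ring
    calc |sievedVonMangoldt ψ R n - vonMangoldtSiegel χ ψ R n|
        ≤ selbergSieve ψ R n * ((n.divisors.card : ℝ) * Real.log n) :=
          hT.trans (mul_le_mul_of_nonneg_left (sum_abs_oneConvChi_mul_le χ n) hν0)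
      _ ≤ selbergSieve ψ R n * ((n.divisors.card : ℝ) * (2 * Real.log x)) := by gcongr
      _ = 2 * ((n.divisors.card : ℝ) * selbergSieve ψ R n * Real.log x) := by ring
      _ ≤ 2 * pairErrE χ ψ η x n := by linarith
      _ ≤ (8 * CL + 2) * (pairErrE χ ψ η x n + pairErrF ψ η ε₀ M x n + pairErrG χ ψ η x n) := by
          nlinarith [mul_nonneg hCL.le hE0]
  · push Not at hEcase
    by_cases hGcase : ∃ P : ℕ, P.Prime ∧ P ∣ n ∧ Real.sqrt (2 * x) < P ∧ realChar χ P ≠ -1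
    · -- Case 3: `n = d p*` with `p* > √(2x)` exceptional
      obtain ⟨P, hP, hPn, hPsq, hPexc⟩ := hGcase
      set d := n / P with hddef
      have hnd : n = d * P := (Nat.div_mul_cancel hPn).symm
      have hd0 : d ≠ 0 := by
        intro h
        rw [h, zero_mul] at hnd
        exact hn0 hnd
      have hdpos : 0 < d := Nat.pos_of_ne_zero hd0
      have hdn : d ∣ n := Dvd.intro P hnd.symm
      have hsqrt0 : 0 ≤ Real.sqrt (2 * x) := Real.sqrt_nonneg _
      have h2x : Real.sqrt (2 * x) * Real.sqrt (2 * x) = 2 * x := Real.mul_self_sqrt (by linarith)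
      have hdP : (d : ℝ) * P ≤ 2 * x := by
        have : ((d * P : ℕ) : ℝ) ≤ 2 * x := by rw [← hnd]; exact hn2x'
        push_cast at this
        exact this
      have hdlt : (d : ℝ) < Real.sqrt (2 * x) := by
        by_contra h
        push Not at h
        have h1 : Real.sqrt (2 * x) * Real.sqrt (2 * x) < (d : ℝ) * P :=
          mul_lt_mul' h hPsq hsqrt0 (by exact_mod_cast hdpos)
        rw [h2x] at h1
        linarith
      have hPd : ¬ P ∣ d := fun h => by
        have : (P : ℝ) ≤ d := by exact_mod_cast Nat.le_of_dvd hdpos h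
        linarith
      have Hd : ∀ p : ℕ, p.Prime → p ∣ d → B ≤ p → realChar χ p = -1 ∧ ¬ p ^ 2 ∣ d := by
        intro p hp hpd hpB
        have hple : (p : ℝ) ≤ Real.sqrt (2 * x) :=
          (show (p : ℝ) ≤ d by exact_mod_cast Nat.le_of_dvd hdpos hpd).trans hdlt.le
        obtain ⟨h1, h2⟩ := hEcase p hp (hpd.trans hdn) (hBR₀ p hpB) hple
        exact ⟨h1, fun h => h2 (h.trans hdn)⟩
      have hTle := sum_le_of_eq_mul_prime χ hχ hP hnd hd0 hPd Hd (B := B)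
      -- `ν(n) = ν(d)`
      have hν : selbergSieve ψ R n = selbergSieve ψ R d := by
        rw [hnd]
        exact selbergSieve_mul_prime hψ hR1 hP (hRle.trans hPsq.le) d
      -- `Λ(d) ν(n) ≤ G(n)`
      have hGge : Λ d * selbergSieve ψ R n ≤ pairErrG χ ψ η x n := by
        by_cases hPup : (P : ℝ) ≤ 2 * x / Real.sqrt R
        · show _ ≤ errG χ ψ R x n
          unfold errG
          have hmem : P ∈ (Finset.range (n + 1)).filter (fun p : ℕ =>
              p.Prime ∧ realChar χ p ≠ -1 ∧ Real.sqrt (2 * x) < (p : ℝ) ∧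
                (p : ℝ) ≤ 2 * x / Real.sqrt R ∧ p ∣ n) :=
            Finset.mem_filter.mpr ⟨Finset.mem_range.mpr
              (Nat.lt_succ_of_le (Nat.le_of_dvd hnpos hPn)), hP, hPexc, hPsq, hPup, hPn⟩
          have h := Finset.single_le_sum (f := fun p => sievedVonMangoldt ψ R (n / p))
            (fun p _ => sievedVonMangoldt_nonneg ψ R (n / p)) hmem
          have h' : sievedVonMangoldt ψ R (n / P) = Λ d * selbergSieve ψ R n := by
            rw [hν]
            rfl
          rw [h'] at h
          exact h
        · push Not at hPup
          have hRpos : 0 < R := by linarith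
          have hsR : 0 < Real.sqrt R := Real.sqrt_pos.mpr hRpos
          have hPpos : (0 : ℝ) < P := by exact_mod_cast hP.pos
          have hdR : (d : ℝ) ^ 2 ≤ R := by
            have h2 : 2 * x < P * Real.sqrt R := by rwa [div_lt_iff₀ hsR] at hPup
            have h3 : (d : ℝ) < Real.sqrt R := by
              by_contra h4
              push Not at h4
              have h6 := mul_le_mul_of_nonneg_left h4 hPpos.le
              rw [mul_comm (P : ℝ) (d : ℝ)] at h6
              linarith
            have h5 : (d : ℝ) ^ 2 < (Real.sqrt R) ^ 2 :=
              pow_lt_pow_left₀ h3 (Nat.cast_nonneg d) two_ne_zero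
            rw [Real.sq_sqrt hRpos.le] at h5
            exact h5.le
          rw [hν]
          rcases eq_or_ne d 1 with hd1 | hd1
          · rw [hd1, ArithmeticFunction.vonMangoldt_apply_one, zero_mul]
            exact hG0
          · rw [selbergSieve_eq_zero_of_sq_le hψ hR1 hd1 hdR, mul_zero]
            exact hG0
      -- assemble
      have hSTd := hST d hd0 hdn
      have hΛd : 0 ≤ Λ d := ArithmeticFunction.vonMangoldt_nonneg
      have hK0 : 0 ≤ 2 * CL * errFSum R₀ D M n := mul_nonneg (mul_nonneg (by norm_num) hCL.le) hFS0
      calc |sievedVonMangoldt ψ R n - vonMangoldtSiegel χ ψ R n|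
          ≤ selbergSieve ψ R n * (2 * smoothTau B d * Real.log n + 2 * Λ d) :=
            hT.trans (mul_le_mul_of_nonneg_left hTle hν0)
        _ = 2 * (smoothTau B d * selbergSieve ψ R n * Real.log n) +
              2 * (Λ d * selbergSieve ψ R n) := by ring
        _ ≤ 2 * (2 * CL * errFSum R₀ D M n * selbergSieve ψ R n * Real.log n) +
              2 * pairErrG χ ψ η x n := by
            gcongr
        _ ≤ 2 * (2 * CL * errFSum R₀ D M n * selbergSieve ψ R n * (2 * Real.log x)) +
              2 * pairErrG χ ψ η x n := by
            gcongr
        _ = 8 * CL * pairErrF ψ η ε₀ M x n + 2 * pairErrG χ ψ η x n := by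
            rw [hFeq]
            ring
        _ ≤ (8 * CL + 2) * (pairErrE χ ψ η x n + pairErrF ψ η ε₀ M x n + pairErrG χ ψ η x n) := by
            nlinarith [mul_nonneg hCL.le hE0, mul_nonneg hCL.le hG0]
    · -- Case 2: the generic case
      push Not at hGcase
      have Hn : ∀ p : ℕ, p.Prime → p ∣ n → B ≤ p → realChar χ p = -1 ∧ ¬ p ^ 2 ∣ n := by
        intro p hp hpn hpB
        by_cases hple : (p : ℝ) ≤ Real.sqrt (2 * x)
        · exact hEcase p hp hpn (hBR₀ p hpB) hple
        · push Not at hple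
          refine ⟨hGcase p hp hpn hple, fun h2 => ?_⟩
          have hle : ((p ^ 2 : ℕ) : ℝ) ≤ n := by exact_mod_cast Nat.le_of_dvd hnpos h2
          push_cast at hle
          have hsq : (Real.sqrt (2 * x)) ^ 2 < (p : ℝ) ^ 2 :=
            pow_lt_pow_left₀ hple (Real.sqrt_nonneg _) two_ne_zero
          rw [Real.sq_sqrt (by linarith)] at hsq
          linarith
      have hTle := sum_le_smoothTau_mul_log χ hχ hn0 Hn (B := B)
      have hSTn := hST n hn0 dvd_rfl
      have hK0 : 0 ≤ 2 * CL * errFSum R₀ D M n := mul_nonneg (mul_nonneg (by norm_num) hCL.le) hFS0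
      calc |sievedVonMangoldt ψ R n - vonMangoldtSiegel χ ψ R n|
          ≤ selbergSieve ψ R n * (smoothTau B n * Real.log n) :=
            hT.trans (mul_le_mul_of_nonneg_left hTle hν0)
        _ = smoothTau B n * selbergSieve ψ R n * Real.log n := by ring
        _ ≤ 2 * CL * errFSum R₀ D M n * selbergSieve ψ R n * Real.log n := by gcongr
        _ ≤ 2 * CL * errFSum R₀ D M n * selbergSieve ψ R n * (2 * Real.log x) := by gcongr
        _ = 4 * CL * pairErrF ψ η ε₀ M x n := by
            rw [hFeq]
            ring
        _ ≤ (8 * CL + 2) * (pairErrE χ ψ η x n + pairErrF ψ η ε₀ M x n + pairErrG χ ψ η x n) := by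
            nlinarith [mul_nonneg hCL.le hE0, mul_nonneg hCL.le hG0, mul_nonneg hCL.le hF0]

end Literature.Barriers.Parity
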